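import Summits.BirchSwinnertonDyer.BirchSwinnertonDyer.Theorems.ThetaPartnerAtTwoSignedTransportAtTwoSharpSurjOfPrint
import Summits.BirchSwinnertonDyer.BirchSwinnertonDyer.Theorems.ThetaPartnerAtTwoSignedTransportAtTwoDecompositionCountAtTwo
import Summits.BirchSwinnertonDyer.Rank1Residual.Additive.LocalZpExtension
import Literature.NumberTheory.EllipticCurves.GreenbergSelmerDualDataExistsProofs
import Literature.NumberTheory.EllipticCurves.IwasawaSelmerControlLocalInputsProofs
import HarnessLib

/-!
# The local generators at the odd places of `S₀`: discharge of the hypotheses `hN`, `hg`, `hgper`, `hginv` of SURJ♯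
# (`sharp_localRes_surjective_of_print4`), and SURJ♯ with only the four printed facts + `Sel_{2^∞}(E/ℚ)` finite left

Route `ThetaPartnerAtTwo` (TP2), crux K1 `SignedTransportAtTwo` (stmt-BirchSwinnertonDyer-20333), line `bridge` v23, stub `stub_surj2`.
Seat `prover-bsd-wall-tp2-p3-w2` (K4 width seat 2/3, g3), serving K1.

WHAT IS PROVED.
* §1 Continuity of the conjugation action on `H¹(L, M)` for a LOCAL `ℤ_p`-extension `κE : Γ_E ↠ ℤ_p` with kernel `L` (any field `E`,
  any discrete `Γ_E`-module `M` whose points have open stabilisers) — the tree's (A1)/(A2) of `GreenbergSelmerDualDataExistsProofs` and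
  `conjH1_eq_self_of_isTopGenerator` of `IwasawaSelmerTorsionProofs`, which are stated over number fields, re-run verbatim over `E`:
  `local_exists_openNormalSubgroup_conjH1_eq`, `local_exists_conjH1_pow_prime_pow_eq` (every class is fixed by `conj_{g^{p^a}}` for a
  topological generator `g`), `local_conjH1_eq_self_of_isTopGenerator` (`conj_g c = c ⇒ conj_δ c = c` for all `δ`).
* §2 `exists_localGenerator_two` — for the cyclotomic `ℤ₂`-extension `κ` of `ℚ` with topological generator `γ` and an odd place `v`:
  there are `s : ℕ` and `g ∈ Γ_{ℚ_v}` with `γ^{2^s} ∈ Gal(ℚ̄/ℚ_∞)·g|_{ℚ̄}`, `κ(Γ_{ℚ_v}|_{ℚ̄}) = ℤ₂·κ(g|_{ℚ̄})` (so `2^s = [Γ : Γ_v]` is the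
  number of places of `ℚ_∞` above `v`), and on `𝒫_v = H¹(Gal(ℚ̄_v/(ℚ_∞)_η), E(ℚ̄_v))` conjugation by `g` has `2`-power order on each class
  and `conj_g c = c ⇒ c` is `Γ_{ℚ_v}`-invariant. Inputs: a Frobenius with `κ ≠ 1` (the computation of `forall_exists_lt_two`), the local
  `ℤ₂`-extension `Rank1Residual.Additive.exists_localZpExtension`, a unit twist, §1.
* §3 `sharp_localRes_surjective_of_print4'` — SURJ♯ (`…SharpSurjOfPrint`) with these generators: granted PUB⁴ and `Sel_{2^∞}(W/ℚ)`
  finite, for EVERY `W` of the row there are `N_v = 2^{s_v}` (the number of places above `v`) and local generators `g_v` as in §2 such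
  that every family of `2`-power-torsion classes `(c_{v,n})_{v ∈ S₀, n < N_v}` in the `𝒫_v` is `(loc_v conj_{γⁿ} c)` for one
  `c ∈ Sel♯_{S₀}(E/ℚ_∞)`.

NOT DONE HERE: the identification `s_v = v₂(ℓ_v² − 1) − 3` (K1's `N_v = 2^{v₂((ℓ²−1)/8)}`; needs the Frobenius generation of
`Γ_{ℚ_v}/I_v`), and the passage to K1's inertia currency. HONEST FRAMING: THEOREMS ONLY (no definition, no named fact, no `sorry`);
conditional on the four PRINTED-but-unproved Greenberg/Cassels/Kato facts and `Finite (Sel_{2^∞}(W/ℚ))`; closes no item; BSD is not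
proved by any of this.

References: [GreenbergVatsal2000] §2 Prop. (2.1), p. 21; [GreenbergLNM1716] §1 p. 60, §3 p. 86, §4 pp. 104–109;
[Washington1997] §13.1; [SerreLocalFields1979] VII §5 Prop. 3; [NeukirchSchmidtWingberg2008] I §5.
-/

set_option autoImplicit false
-- the Theorems namespace of this sub repeats the summit name by design (D-0017 nested layout)
set_option linter.dupNamespace false

noncomputable section

open scoped Classical NumberField

open NumberField IsDedekindDomain

namespace Summit.BirchSwinnertonDyer.BirchSwinnertonDyer.Theorems.SignedEC

open Literature.NumberTheory.EllipticCurves Literature.NumberTheory.GaloisRepresentations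
  WeierstrassCurve ZpExtension Literature.NumberTheory.EllipticCurves.Kobayashi2003
  Literature.NumberTheory.EllipticCurves.IwasawaDual Literature.NumberTheory.EllipticCurves.IwasawaAlgebra
  Literature.NumberTheory.EllipticCurves.GreenbergVatsal2000 Literature.NumberTheory.EllipticCurves.Rank1Residual
  Literature.NumberTheory.EllipticCurves.Sprung2012 Summit.BirchSwinnertonDyer.Rank1Residual.Additive

universe u

/-! ## §1. Continuity of conjugation on `H¹(L, M)` for a local `ℤ_p`-extension -/

section Local

variable {E : Type u} [Field E] {p : ℕ} [Fact p.Prime] (κE : ZpExtension E p)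
  (L : Subgroup (Field.absoluteGaloisGroup E)) [L.Normal] (hL : ∀ σ : Field.absoluteGaloisGroup E, σ ∈ L ↔ κE σ = 1)
  (M : Type u) [AddCommGroup M] [DistribMulAction (Field.absoluteGaloisGroup E) M] [TopologicalSpace M] [DiscreteTopology M]
  (hstab : ∀ m : M, IsOpen (MulAction.stabilizer (Field.absoluteGaloisGroup E) m : Set (Field.absoluteGaloisGroup E)))

include hL hstab in
/-- **(A1) over any field**: every class of `H¹(L, M)` is fixed by `conj_τ` for `τ` in an open normal subgroup of `Γ_E` (points of
`M` have open stabilisers) — the tree's `exists_openNormalSubgroup_conjH1_eq` (stated over number fields) re-run verbatim.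
[cite: GreenbergLNM1716, §1 (after Conj. 1.3)] [cite: NeukirchSchmidtWingberg2008, I.§5] -/
theorem local_exists_openNormalSubgroup_conjH1_eq (c : subgroupH1 L M) :
    ∃ Nrm : OpenNormalSubgroup (Field.absoluteGaloisGroup E),
      ∀ τ ∈ Nrm, Literature.NumberTheory.EllipticCurves.conjH1 L M τ c = c := by
  -- adapted from `GreenbergSelmerDualDataExistsProofs.exists_openNormalSubgroup_conjH1_eq`
  haveI : CompactSpace (Field.absoluteGaloisGroup E) := absoluteGaloisGroup_compactSpace E
  have hLc : IsClosed (L : Set (Field.absoluteGaloisGroup E)) := by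
    have e : (L : Set (Field.absoluteGaloisGroup E)) = κE.toContinuousMonoidHom ⁻¹' {1} := Set.ext fun σ ↦ hL σ
    rw [e]
    exact isClosed_singleton.preimage κE.toContinuousMonoidHom.continuous_toFun
  haveI : CompactSpace L := isCompact_iff_compactSpace.mp hLc.isCompact
  obtain ⟨φ, rfl⟩ := oneCocycleClass_surjective _ c
  have hfin : (Set.range φ.1).Finite := (isCompact_range φ.1.continuous).finite_of_discrete
  set Ufix : Set (Field.absoluteGaloisGroup E) := {τ | ∀ m ∈ Set.range φ.1, τ • m = m} with hUfix_def
  have hUfix : IsOpen Ufix := by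
    have e : Ufix = ⋂ m ∈ Set.range φ.1,
        (MulAction.stabilizer (Field.absoluteGaloisGroup E) m : Set (Field.absoluteGaloisGroup E)) := by
      ext τ
      simp only [hUfix_def, Set.mem_setOf_eq, Set.mem_iInter, SetLike.mem_coe, MulAction.mem_stabilizer_iff]
    rw [e]
    exact hfin.isOpen_biInter fun m _ ↦ hstab m
  have hz : IsOpen {h : L | φ.1 h = 0} := (isOpen_discrete ({0} : Set M)).preimage φ.1.continuous
  obtain ⟨U0, hU0, hU0eq⟩ := isOpen_induced_iff.mp hz
  have h1fix : (1 : Field.absoluteGaloisGroup E) ∈ Ufix := fun m _ ↦ one_smul _ m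
  have h1U0 : (1 : Field.absoluteGaloisGroup E) ∈ U0 := by
    have : (1 : L) ∈ Subtype.val ⁻¹' U0 := by
      rw [hU0eq]
      exact contOneCocycles.apply_one φ
    exact this
  obtain ⟨Nrm, hNrm⟩ := ProfiniteGrp.exist_openNormalSubgroup_sub_open_nhds_of_one (hUfix.inter hU0) ⟨h1fix, h1U0⟩
  refine ⟨Nrm, fun τ hτ ↦ IwasawaDual.conjH1_oneCocycleClass_eq φ (fun h ↦ ?_) (fun h n hn ↦ ?_)⟩
  · exact (hNrm hτ).1 _ ⟨h, rfl⟩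
  · have hnN : (n : Field.absoluteGaloisGroup E) ∈ Nrm := by
      rw [hn]
      have h1 : (h : Field.absoluteGaloisGroup E)⁻¹ * τ⁻¹ * (h : Field.absoluteGaloisGroup E)⁻¹⁻¹ ∈ Nrm.toSubgroup :=
        Subgroup.Normal.conj_mem inferInstance _ (Nrm.toSubgroup.inv_mem hτ) _
      rw [inv_inv] at h1
      exact Nrm.toSubgroup.mul_mem h1 hτ
    have hn0 : n ∈ Subtype.val ⁻¹' U0 := (hNrm hnN).2
    rw [hU0eq] at hn0
    exact hn0

include hL hstab in
/-- **(A2) over any field**: for a topological generator `g` of the local `ℤ_p`-extension (`κE g = 1 ∈ ℤ_p`), every class of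
`H¹(L, M)` is fixed by `conj_{g^{p^a}}` for some `a` — the tree's `exists_conjH1_pow_prime_pow_eq` re-run verbatim.
[cite: GreenbergLNM1716, §1 (after Conj. 1.3)] [cite: SerreLocalFields1979, VII.§5 Prop. 3] -/
theorem local_exists_conjH1_pow_prime_pow_eq {g : Field.absoluteGaloisGroup E} (hg : κE.IsTopGenerator g)
    (c : subgroupH1 L M) :
    ∃ a : ℕ, Literature.NumberTheory.EllipticCurves.conjH1 L M (g ^ p ^ a) c = c := by
  -- adapted from `GreenbergSelmerDualDataExistsProofs.exists_conjH1_pow_prime_pow_eq`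
  obtain ⟨Nrm, hNrm⟩ := local_exists_openNormalSubgroup_conjH1_eq κE L hL M hstab c
  haveI : CompactSpace (Field.absoluteGaloisGroup E) := absoluteGaloisGroup_compactSpace E
  haveI : Finite (Field.absoluteGaloisGroup E ⧸ Nrm.toSubgroup) := Subgroup.quotient_finite_of_isOpen _ Nrm.isOpen
  have hd : Nrm.toSubgroup.index ≠ 0 := Subgroup.index_ne_zero_of_finite
  obtain ⟨a, e, he, hde⟩ := Nat.exists_eq_pow_mul_and_not_dvd hd p (Fact.out : p.Prime).ne_one
  obtain ⟨u, hu⟩ := IwasawaDual.isUnit_natCast_padicInt (p := p) he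
  obtain ⟨g₀, hg₀⟩ := κE.surjective (Multiplicative.ofAdd ((u⁻¹ : ℤ_[p]ˣ) : ℤ_[p]))
  have hg₀' : κE g₀ = Multiplicative.ofAdd ((u⁻¹ : ℤ_[p]ˣ) : ℤ_[p]) := hg₀
  have hτN : g₀ ^ Nrm.toSubgroup.index ∈ Nrm := Nrm.toSubgroup.pow_index_mem g₀
  have hκτ : (κE (g₀ ^ Nrm.toSubgroup.index)).toAdd = (p : ℤ_[p]) ^ a := by
    rw [map_pow, hg₀', ← ofAdd_nsmul, toAdd_ofAdd, nsmul_eq_mul, hde, Nat.cast_mul, Nat.cast_pow,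
      ← hu, mul_assoc, Units.mul_inv, mul_one]
  have hκγ : (κE (g ^ p ^ a)).toAdd = (p : ℤ_[p]) ^ a := by
    rw [map_pow, show κE g = Multiplicative.ofAdd 1 from hg, ← ofAdd_nsmul, toAdd_ofAdd, nsmul_eq_mul,
      mul_one, Nat.cast_pow]
  have hh₀ : (g₀ ^ Nrm.toSubgroup.index)⁻¹ * g ^ p ^ a ∈ L := by
    rw [hL, map_mul, map_inv]
    apply Multiplicative.toAdd.injective
    rw [toAdd_mul, toAdd_inv, hκτ, hκγ, toAdd_one, neg_add_cancel]
  refine ⟨a, ?_⟩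
  conv_lhs => rw [← mul_inv_cancel_left (g₀ ^ Nrm.toSubgroup.index) (g ^ p ^ a)]
  rw [Literature.NumberTheory.EllipticCurves.conjH1_mul_holds L M, AddMonoidHom.comp_apply,
    Literature.NumberTheory.EllipticCurves.conjH1_of_mem_holds L M hh₀, AddMonoidHom.id_apply]
  exact hNrm _ hτN

include hL hstab in
/-- **`H¹(L, M)^g = H¹(L, M)^{Γ_E}` for a topological generator `g` of the local `ℤ_p`-extension** — the tree's
`conjH1_eq_self_of_isTopGenerator` (number fields, `M = E[p^∞]`) re-run verbatim over `E` for a discrete `M`.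
[cite: GreenbergLNM1716, §1 p. 60 and §3 p. 86] [cite: SerreLocalFields1979, VII.§5 Prop. 3] -/
theorem local_conjH1_eq_self_of_isTopGenerator {g : Field.absoluteGaloisGroup E} (hg : κE.IsTopGenerator g)
    {c : subgroupH1 L M} (hc : Literature.NumberTheory.EllipticCurves.conjH1 L M g c = c)
    (σ : Field.absoluteGaloisGroup E) :
    Literature.NumberTheory.EllipticCurves.conjH1 L M σ c = c := by
  -- adapted from `IwasawaSelmerTorsionProofs.conjH1_eq_self_of_isTopGenerator`
  obtain ⟨Nrm, hNrm⟩ := local_exists_openNormalSubgroup_conjH1_eq κE L hL M hstab c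
  haveI : CompactSpace (Field.absoluteGaloisGroup E) := absoluteGaloisGroup_compactSpace E
  haveI : Finite (Field.absoluteGaloisGroup E ⧸ Nrm.toSubgroup) := Subgroup.quotient_finite_of_isOpen _ Nrm.isOpen
  have hd : Nrm.toSubgroup.index ≠ 0 := Subgroup.index_ne_zero_of_finite
  obtain ⟨a, e, he, hde⟩ := Nat.exists_eq_pow_mul_and_not_dvd hd p (Fact.out : p.Prime).ne_one
  obtain ⟨u, hu⟩ := IwasawaDual.isUnit_natCast_padicInt (p := p) he
  -- powers of `g` fix `c`
  have hγk : ∀ k : ℕ, Literature.NumberTheory.EllipticCurves.conjH1 L M (g ^ k) c = c := fun k ↦ conjH1_pow_eq_self L M hc k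
  -- `κE σ = k + p^a z` with `k ∈ ℕ`
  obtain ⟨z, hz⟩ := Ideal.mem_span_singleton.mp (PadicInt.appr_spec a (κE σ).toAdd)
  -- `ν = g₁^{[Γ_E : Nrm]} ∈ Nrm` with `κE ν = p^a z`
  obtain ⟨g₁, hg₁⟩ := κE.surjective (Multiplicative.ofAdd (z * ((u⁻¹ : ℤ_[p]ˣ) : ℤ_[p])))
  have hg₁' : κE g₁ = Multiplicative.ofAdd (z * ((u⁻¹ : ℤ_[p]ˣ) : ℤ_[p])) := hg₁
  have hνN : g₁ ^ Nrm.toSubgroup.index ∈ Nrm := Nrm.toSubgroup.pow_index_mem g₁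
  have hκν : (κE (g₁ ^ Nrm.toSubgroup.index)).toAdd = (p : ℤ_[p]) ^ a * z := by
    rw [map_pow, hg₁', ← ofAdd_nsmul, toAdd_ofAdd, nsmul_eq_mul, hde, Nat.cast_mul, Nat.cast_pow,
      ← hu, mul_comm z, ← mul_assoc, Units.mul_inv_cancel_right]
  have hκγk : (κE (g ^ PadicInt.appr (κE σ).toAdd a)).toAdd = (PadicInt.appr (κE σ).toAdd a : ℤ_[p]) := by
    rw [map_pow, show κE g = Multiplicative.ofAdd 1 from hg, ← ofAdd_nsmul, toAdd_ofAdd, nsmul_eq_mul, mul_one]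
  -- `h = σ g^{-k} ν⁻¹ ∈ L`
  have hh : σ * (g ^ PadicInt.appr (κE σ).toAdd a)⁻¹ * (g₁ ^ Nrm.toSubgroup.index)⁻¹ ∈ L := by
    rw [hL, map_mul, map_mul, map_inv, map_inv]
    apply Multiplicative.toAdd.injective
    rw [toAdd_mul, toAdd_mul, toAdd_inv, toAdd_inv, hκν, hκγk, toAdd_one]
    linear_combination hz
  have hdecomp : σ = σ * (g ^ PadicInt.appr (κE σ).toAdd a)⁻¹ * (g₁ ^ Nrm.toSubgroup.index)⁻¹ *
      g₁ ^ Nrm.toSubgroup.index * g ^ PadicInt.appr (κE σ).toAdd a := by group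
  conv_lhs => rw [hdecomp]
  rw [Literature.NumberTheory.EllipticCurves.conjH1_mul_holds L M _ (g ^ _), AddMonoidHom.comp_apply, hγk,
    Literature.NumberTheory.EllipticCurves.conjH1_mul_holds L M _ (g₁ ^ _), AddMonoidHom.comp_apply, hNrm _ hνN,
    Literature.NumberTheory.EllipticCurves.conjH1_of_mem_holds L M hh, AddMonoidHom.id_apply]

end Local

/-! ## §2. The local generator at an odd place of `ℚ` for the cyclotomic `ℤ₂`-extension -/

variable (W : WeierstrassCurve ℚ) [W.IsElliptic] [W.IsGloballyMinimal]

omit [W.IsElliptic] [W.IsGloballyMinimal] in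
open Literature.NumberTheory.EllipticCurves.CyclotomicZp Literature.NumberTheory.EllipticCurves.PadicOneUnits
  Summit.BirchSwinnertonDyer.Rank1Residual.Iwasawa Summit.BirchSwinnertonDyer.Rank1Residual.X2
  Summit.BirchSwinnertonDyer.Rank1Residual.X2.CyclotomicDecompositionCount in
/-- **The local generator at an odd place.** `κ` the cyclotomic `ℤ₂`-extension of `ℚ`, `γ` a topological generator, `v ∤ 2`. There
are `s : ℕ` and `g ∈ Γ_{ℚ_v}` such that: `γ^{2^s} = h · g|_{ℚ̄}` with `h ∈ Gal(ℚ̄/ℚ_∞)`; `κ(δ|_{ℚ̄}) ∈ ℤ₂ · κ(g|_{ℚ̄})` for every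
`δ ∈ Γ_{ℚ_v}` (so `2^s = [Γ : Γ_v]`, the number of places of `ℚ_∞` above `v`); and on
`𝒫_v = H¹(Gal(ℚ̄_v/(ℚ_∞)_η), E(ℚ̄_v))` every class is fixed by some `conj_{g^{2^j}}` and `conj_g c = c ⇒ conj_δ c = c` for all `δ`.
A Frobenius has `κ ≠ 1` (computation of `forall_exists_lt_two`); then `Rank1Residual.Additive.exists_localZpExtension`, a unit twist,
and §1. [cite: GreenbergVatsal2000, §2 p. 21] [cite: Washington1997, §13.1] [cite: GreenbergLNM1716, §3 p. 86] -/
theorem exists_localGenerator_two (κ : ZpExtension ℚ 2) (hκ : κ.IsCyclotomic) {γ : Field.absoluteGaloisGroup ℚ}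
    (hγ : κ.IsTopGenerator γ) (v : HeightOneSpectrum (𝓞 ℚ)) (hpv : ((2 : ℕ) : 𝓞 ℚ) ∉ v.asIdeal) :
    ∃ (s : ℕ) (g : Field.absoluteGaloisGroup (v.adicCompletion ℚ)),
      (∃ h ∈ κ.kerSubgroup, γ ^ 2 ^ s = h * resGal (K := ℚ) (v.adicCompletion ℚ) g) ∧
      (∀ δ : Field.absoluteGaloisGroup (v.adicCompletion ℚ), ∃ z : ℤ_[2],
        (κ (resGal (K := ℚ) (v.adicCompletion ℚ) δ)).toAdd = z * (κ (resGal (K := ℚ) (v.adicCompletion ℚ) g)).toAdd) ∧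
      (κ (resGal (K := ℚ) (v.adicCompletion ℚ) g)).toAdd = (2 : ℤ_[2]) ^ s ∧
      (∀ c : discreteH1 (localSubgroup κ.kerSubgroup (v.adicCompletion ℚ)) (localPoints W (v.adicCompletion ℚ)),
        ∃ j : ℕ, Literature.NumberTheory.EllipticCurves.conjH1 (localSubgroup κ.kerSubgroup (v.adicCompletion ℚ))
          (localPoints W (v.adicCompletion ℚ)) (g ^ 2 ^ j) c = c) ∧
      (∀ c : discreteH1 (localSubgroup κ.kerSubgroup (v.adicCompletion ℚ)) (localPoints W (v.adicCompletion ℚ)),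
        Literature.NumberTheory.EllipticCurves.conjH1 (localSubgroup κ.kerSubgroup (v.adicCompletion ℚ))
            (localPoints W (v.adicCompletion ℚ)) g c = c →
        ∀ δ : Field.absoluteGaloisGroup (v.adicCompletion ℚ),
          Literature.NumberTheory.EllipticCurves.conjH1 (localSubgroup κ.kerSubgroup (v.adicCompletion ℚ))
            (localPoints W (v.adicCompletion ℚ)) δ c = c) := by
  -- a Frobenius restricts outside `ker κ` (as in `SignedTransportAtTwo.forall_exists_lt_two`)
  have hE : ∃ δ : Field.absoluteGaloisGroup (v.adicCompletion ℚ), resGal (K := ℚ) (v.adicCompletion ℚ) δ ∉ κ.kerSubgroup := by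
    set ℓ := Rat.HeightOneSpectrum.natGenerator v with hℓ
    have hℓp : ℓ ≠ 2 := EulerFactorInvariants.natGenerator_ne_of_natCast_not_mem v hpv
    have hℓprime : ℓ.Prime := Rat.HeightOneSpectrum.prime_natGenerator v
    have hcop : (2 : ℕ).Coprime ℓ := (Nat.coprime_primes Nat.prime_two hℓprime).2 (Ne.symm hℓp)
    have h1ℓ : 1 < ℓ := hℓprime.one_lt
    obtain ⟨τ, hτ⟩ := exists_isAbsArithFrob_holds (F := v.adicCompletion ℚ)
    refine ⟨τ, fun hmem ↦ ?_⟩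
    rw [resGal_eq_absGaloisRestrict] at hmem
    set δ₀ := absGaloisRestrict ℚ (v.adicCompletion ℚ) τ with hδ₀
    have hχ : ((GaloisRep.cyclotomicCharacter ℚ 2 δ₀ : ℤ_[2]ˣ) : ℤ_[2]) = (ℓ : ℤ_[2]) :=
      cyclotomicCharacter_absGaloisRestrict_of_isAbsArithFrob hpv hτ
    obtain ⟨u, hu⟩ := ZpExtension.IsCyclotomic.exists_eq_unitTwist_holds (CyclotomicZp.isCyclotomic_zpExtension 2) hκ
    have hκδ₀ : (κ δ₀).toAdd = (u : ℤ_[2]) * frobeniusExponent 2 (ℓ : ℤ_[2]) := by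
      rw [hu, ZpExtension.unitTwist_apply, toAdd_ofAdd, CyclotomicZp.zpExtension_apply, toAdd_ofAdd,
        frobeniusExponent_of_isUnit (EulerFactorAlgebra.isUnit_natCast_of_coprime hcop)]
      congr 2
      exact Units.ext (by rw [hχ, IsUnit.unit_spec])
    have hf0 : frobeniusExponent 2 (ℓ : ℤ_[2]) ≠ 0 :=
      EulerFactorAlgebra.frobeniusExponent_natCast_ne_zero hcop h1ℓ
    have hu0 : (u : ℤ_[2]) ≠ 0 := Units.ne_zero u
    have h0 : (κ δ₀).toAdd = 0 := by rw [ZpExtension.mem_kerSubgroup.mp hmem]; rfl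
    rw [hκδ₀] at h0
    exact (mul_ne_zero hu0 hf0) h0
  -- the local `ℤ₂`-extension with kernel `L = Gal(ℚ̄_v/(ℚ_∞)_η)` and a generator `g₀`
  obtain ⟨κE, g₀, hker, hg₀, hform⟩ := Summit.BirchSwinnertonDyer.Rank1Residual.Additive.exists_localZpExtension κ (v.adicCompletion ℚ) hE
  set a : ℤ_[2] := (κ (resGal (K := ℚ) (v.adicCompletion ℚ) g₀)).toAdd with ha
  have ha0 : a ≠ 0 := by
    intro h0
    obtain ⟨δ, hδ⟩ := hE
    apply hδ
    rw [ZpExtension.mem_kerSubgroup]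
    apply Multiplicative.toAdd.injective
    rw [hform δ, h0, mul_zero, toAdd_one]
  -- `a = w · 2^s`
  set s : ℕ := a.valuation with hs
  set w : ℤ_[2]ˣ := PadicInt.unitCoeff ha0 with hw
  have haw : a = (w : ℤ_[2]) * (2 : ℤ_[2]) ^ s := by
    have := PadicInt.unitCoeff_spec ha0
    exact_mod_cast this
  -- the generator `g` with `κ(g|) = 2^s`, and the twisted local extension with `κE' g = 1`
  obtain ⟨g, hgw⟩ := κE.surjective (Multiplicative.ofAdd ((w⁻¹ : ℤ_[2]ˣ) : ℤ_[2]))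
  have hgw' : κE g = Multiplicative.ofAdd ((w⁻¹ : ℤ_[2]ˣ) : ℤ_[2]) := hgw
  have hκg : (κ (resGal (K := ℚ) (v.adicCompletion ℚ) g)).toAdd = (2 : ℤ_[2]) ^ s := by
    rw [hform g, hgw', toAdd_ofAdd, haw, ← mul_assoc, Units.inv_mul, one_mul]
  set κE' : ZpExtension (v.adicCompletion ℚ) 2 := κE.unitTwist w with hκE'
  have hg1 : κE'.IsTopGenerator g := by
    change κE' g = Multiplicative.ofAdd 1
    rw [hκE', ZpExtension.unitTwist_apply, hgw', toAdd_ofAdd, Units.mul_inv]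
  have hL : ∀ σ : Field.absoluteGaloisGroup (v.adicCompletion ℚ), σ ∈ localSubgroup κ.kerSubgroup (v.adicCompletion ℚ) ↔ κE' σ = 1 := by
    intro σ
    rw [← hker, ← ZpExtension.kerSubgroup_unitTwist κE w, ← hκE']
    exact ZpExtension.mem_kerSubgroup
  have hstab := WeierstrassCurve.isOpen_stabilizer_localPoints W (v.adicCompletion ℚ)
  refine ⟨s, g, ?_, ?_, hκg, ?_, ?_⟩
  · -- `γ^{2^s} = h · g|`
    refine ⟨γ ^ 2 ^ s * (resGal (K := ℚ) (v.adicCompletion ℚ) g)⁻¹, ?_, by rw [inv_mul_cancel_right]⟩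
    rw [ZpExtension.mem_kerSubgroup, map_mul, map_inv]
    apply Multiplicative.toAdd.injective
    rw [toAdd_mul, toAdd_inv, hκg, map_pow, show κ γ = Multiplicative.ofAdd 1 from hγ, ← ofAdd_nsmul, toAdd_ofAdd,
      nsmul_eq_mul, mul_one, Nat.cast_pow, Nat.cast_ofNat, toAdd_one, add_neg_cancel]
  · -- `κ(D_v) = ℤ₂ · κ(g|)`
    intro δ
    refine ⟨(κE δ).toAdd * (w : ℤ_[2]), ?_⟩
    rw [hform δ, hκg, haw]
    ring
  · intro c
    exact local_exists_conjH1_pow_prime_pow_eq κE' (localSubgroup κ.kerSubgroup (v.adicCompletion ℚ)) hL (localPoints W (v.adicCompletion ℚ)) hstab hg1 c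
  · intro c hc δ
    exact local_conjH1_eq_self_of_isTopGenerator κE' (localSubgroup κ.kerSubgroup (v.adicCompletion ℚ)) hL (localPoints W (v.adicCompletion ℚ)) hstab hg1 hc δ

/-! ## §3. SURJ♯ with the local generators discharged -/

/-- **SURJ♯ at `2` (GV Prop. (2.1) signed, READ AT `2`, `𝒫`-currency) from the four printed facts and `Sel_{2^∞}(E/ℚ)` finite, with the
local generators of §2**: `W/ℚ` globally minimal, `GoodSS W 2`, `a₂(W) = 0`, `κ` cyclotomic with topological generator `γ`, `S₀` a
finite set of odd places containing the bad ones, `Sel_{2^∞}(W/ℚ)` finite, PUB⁴ by name. Then there are, for the places `v`, numbers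
`N_v = 2^{s_v}` and `g_v ∈ Γ_{ℚ_v}` with `γ^{N_v} ∈ Gal(ℚ̄/ℚ_∞)·g_v|`, `κ(Γ_{ℚ_v}|) = ℤ₂·κ(g_v|)`, `κ(g_v|) = 2^{s_v}` — so `N_v` is the
number of places of `ℚ_∞` above `v` — such that EVERY family `(c_{v,n})_{v ∈ S₀, n < N_v}` of `2`-power-torsion classes
`c_{v,n} ∈ H¹(Gal(ℚ̄_v/(ℚ_∞)_η), E(ℚ̄_v))` is `(loc_v(conj_{γⁿ} c))` for one `c ∈ Sel♯_{S₀}(E/ℚ_∞)`.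
[cite: GreenbergVatsal2000, §2 Prop. (2.1) (p. 23)] [cite: GreenbergLNM1716, §4 pp. 104, 107–109, p. 119, Props. 4.12–4.13] -/
theorem sharp_localRes_surjective_of_print4' (hC : Greenberg1999.casselsSurjectivity_H1Sigma ℚ)
    (h412 : Greenberg1999.prop412_noFiniteSubmodule_H1Sigma_of_rank_one)
    (hcork : Greenberg1999.h1Sigma_zpCorank_le_degree ℚ) (hWL : Greenberg1999.h1SigmaInfty_rank_eq_one)
    (hss : GoodSS W 2) (ha : W.frobeniusTrace 2 = 0) {κ : ZpExtension ℚ 2} (hκ : κ.IsCyclotomic)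
    {γ : Field.absoluteGaloisGroup ℚ} (hγ : κ.IsTopGenerator γ)
    (S₀ : Finset (HeightOneSpectrum (𝓞 ℚ))) (hS₀ : ∀ v ∈ S₀, ((2 : ℕ) : 𝓞 ℚ) ∉ v.asIdeal)
    (hS : ∀ v : HeightOneSpectrum (𝓞 ℚ), ¬ W.HasGoodReductionAt v → v ∈ S₀) (hSel : Finite (W.selmerGroupPInfty 2)) :
    ∃ (N : HeightOneSpectrum (𝓞 ℚ) → ℕ) (g : ∀ v : HeightOneSpectrum (𝓞 ℚ), Field.absoluteGaloisGroup (v.adicCompletion ℚ)),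
      (∀ v ∈ S₀, (∃ s : ℕ, N v = 2 ^ s ∧ (κ (resGal (K := ℚ) (v.adicCompletion ℚ) (g v))).toAdd = (2 : ℤ_[2]) ^ s) ∧
        (∃ h ∈ κ.kerSubgroup, γ ^ N v = h * resGal (K := ℚ) (v.adicCompletion ℚ) (g v)) ∧
        ∀ δ : Field.absoluteGaloisGroup (v.adicCompletion ℚ), ∃ z : ℤ_[2],
          (κ (resGal (K := ℚ) (v.adicCompletion ℚ) δ)).toAdd = z * (κ (resGal (K := ℚ) (v.adicCompletion ℚ) (g v))).toAdd) ∧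
      ∀ (y : ∀ v : HeightOneSpectrum (𝓞 ℚ), ℕ →
          discreteH1 (localSubgroup κ.kerSubgroup (v.adicCompletion ℚ)) (localPoints W (v.adicCompletion ℚ))),
        (∀ v ∈ S₀, ∀ n < N v, ∃ k : ℕ, 2 ^ k • y v n = 0) →
        ∃ c ∈ unramifiedOutside κ.kerSubgroup ↥(W.geomPrimaryTorsion 2) 2 (↑S₀ : Set (HeightOneSpectrum (𝓞 ℚ))) ⊓
            ⨅ (v : HeightOneSpectrum (𝓞 ℚ)) (_ : ((2 : ℕ) : 𝓞 ℚ) ∈ v.asIdeal) (σ : Field.absoluteGaloisGroup ℚ),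
              (localKummerOverOfEmb W 2 κ.kerSubgroup (closureEmb (K := ℚ) (v.adicCompletion ℚ))
                (⨆ n : ℕ, signedLocalPoints κ (v.adicCompletion ℚ) W 1 n)).comap (W.conjH1 2 κ.kerSubgroup σ),
          ∀ v ∈ S₀, ∀ n < N v,
            W.localResOver 2 κ.kerSubgroup (v.adicCompletion ℚ) (W.conjH1 2 κ.kerSubgroup (γ ^ n) c) = y v n := by
  -- the local generators at the odd places (junk elsewhere)
  have hgen : ∀ v : HeightOneSpectrum (𝓞 ℚ), ∃ (s : ℕ) (g : Field.absoluteGaloisGroup (v.adicCompletion ℚ)),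
      ((2 : ℕ) : 𝓞 ℚ) ∉ v.asIdeal →
      (∃ h ∈ κ.kerSubgroup, γ ^ 2 ^ s = h * resGal (K := ℚ) (v.adicCompletion ℚ) g) ∧
      (∀ δ : Field.absoluteGaloisGroup (v.adicCompletion ℚ), ∃ z : ℤ_[2],
        (κ (resGal (K := ℚ) (v.adicCompletion ℚ) δ)).toAdd = z * (κ (resGal (K := ℚ) (v.adicCompletion ℚ) g)).toAdd) ∧
      (κ (resGal (K := ℚ) (v.adicCompletion ℚ) g)).toAdd = (2 : ℤ_[2]) ^ s ∧
      (∀ c : discreteH1 (localSubgroup κ.kerSubgroup (v.adicCompletion ℚ)) (localPoints W (v.adicCompletion ℚ)),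
        ∃ j : ℕ, Literature.NumberTheory.EllipticCurves.conjH1 (localSubgroup κ.kerSubgroup (v.adicCompletion ℚ))
          (localPoints W (v.adicCompletion ℚ)) (g ^ 2 ^ j) c = c) ∧
      (∀ c : discreteH1 (localSubgroup κ.kerSubgroup (v.adicCompletion ℚ)) (localPoints W (v.adicCompletion ℚ)),
        Literature.NumberTheory.EllipticCurves.conjH1 (localSubgroup κ.kerSubgroup (v.adicCompletion ℚ))
            (localPoints W (v.adicCompletion ℚ)) g c = c →
        ∀ δ : Field.absoluteGaloisGroup (v.adicCompletion ℚ),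
          Literature.NumberTheory.EllipticCurves.conjH1 (localSubgroup κ.kerSubgroup (v.adicCompletion ℚ))
            (localPoints W (v.adicCompletion ℚ)) δ c = c) := by
    intro v
    by_cases hpv : ((2 : ℕ) : 𝓞 ℚ) ∈ v.asIdeal
    · exact ⟨0, 1, fun h ↦ absurd hpv h⟩
    · obtain ⟨s, g, h1, h2, h3, h4, h5⟩ := exists_localGenerator_two W κ hκ hγ v hpv
      exact ⟨s, g, fun _ ↦ ⟨h1, h2, h3, h4, h5⟩⟩
  choose s g hsg using hgen
  refine ⟨fun v ↦ 2 ^ s v, g, fun v hv ↦ ?_, fun y hy ↦ ?_⟩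
  · obtain ⟨h1, h2, h3, -, -⟩ := hsg v (hS₀ v hv)
    exact ⟨⟨s v, rfl, h3⟩, h1, h2⟩
  · exact sharp_localRes_surjective_of_print4 W hC h412 hcork hWL hss ha hκ hγ S₀ hS₀ hS hSel (fun v ↦ 2 ^ s v)
      (fun v _ ↦ ⟨s v, rfl⟩) g (fun v hv ↦ (hsg v (hS₀ v hv)).1)
      (fun v hv c _ ↦ (hsg v (hS₀ v hv)).2.2.2.1 c) (fun v hv c _ hc ↦ (hsg v (hS₀ v hv)).2.2.2.2 c hc) y hy

end Summit.BirchSwinnertonDyer.BirchSwinnertonDyer.Theorems.SignedEC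

end
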